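import Summits.BirchSwinnertonDyer.BirchSwinnertonDyer.Theorems.GenusKolyvaginAtTwoShaCardDvdPowAtTwoPosT
import Summits.BirchSwinnertonDyer.BirchSwinnertonDyer.Theorems.GenusKolyvaginAtTwoKolyvaginExactAtTwoPosDiscTOfHalves
import HarnessLib

/-!
# Route `GenusKolyvaginAtTwo` — Q4_T″ `KolyvaginExactAtTwoPosDiscT` (stmt-BirchSwinnertonDyer-25502) REDUCED TO L⁺_T′ ALONE

Seat `bsd-line-gk2-p1` g20 (LEAD, cell `bsd-f1-sign2`), `--supports stmt-BirchSwinnertonDyer-25502`.  THEOREM ONLY (no definition, no named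
fact, no `sorry`).  BSD is NOT proved by this file, and Q4_T″ is NOT proved by it either: this is the CONDITIONAL one-step closer — with U⁺_T′
`ShaCardDvdPowAtTwoPosT` now a theorem (`Theorems.shaCardDvdPowAtTwoPosT_proof`, p757977, item stmt-25500 closed `proved`) and the glue
`KolyvaginExactAtTwoPosDiscTOfHalves` a theorem (`GenusExact.kolyvaginExactAtTwoPosDiscTOfHalves_proof`, p757700), the crux Q4_T″ follows from the
single remaining half L⁺_T′ `PowDvdShaCardAtTwoPosT` (stmt-BirchSwinnertonDyer-25501, road (E4)⁺: gk2-p2 KS⁺ assembly ∘ gk2-p4 hK⁺/hbot⁺ ∘ gk2-p5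
swap⁺).  When `powDvdShaCardAtTwoPosT_proof : PowDvdShaCardAtTwoPosT` lands, the by-name closer of stmt-25502 is the one-liner
`kolyvaginExactAtTwoPosDiscT_of_powDvdShaCardAtTwoPosT powDvdShaCardAtTwoPosT_proof`.
References: [McCallumLMS1991] §5 Thm. 5.4, Cor. 5.6; [Kolyvagin1989Izv] Thm. B₂, C; [GrossLMS1991] §5 Prop. 5.3.
-/

set_option autoImplicit false

namespace Summit.BirchSwinnertonDyer.BirchSwinnertonDyer.Theorems

open Summit.BirchSwinnertonDyer.BirchSwinnertonDyer.Theses.GenusKolyvaginAtTwo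

/-- **Q4_T″ from L⁺_T′ alone**: `PowDvdShaCardAtTwoPosT → KolyvaginExactAtTwoPosDiscT` — the glue `KolyvaginExactAtTwoPosDiscTOfHalves`
(p757700) applied to the landed upper half U⁺_T′ `shaCardDvdPowAtTwoPosT_proof` (p757977).  CONDITIONAL on the route decl
`PowDvdShaCardAtTwoPosT` (stmt-BirchSwinnertonDyer-25501, open); BSD is NOT proved by this.
[cite: McCallumLMS1991, §5 Cor. 5.6] [cite: Kolyvagin1989Izv, Thm. C] -/
theorem kolyvaginExactAtTwoPosDiscT_of_powDvdShaCardAtTwoPosT (hL : PowDvdShaCardAtTwoPosT) :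
    KolyvaginExactAtTwoPosDiscT :=
  GenusExact.kolyvaginExactAtTwoPosDiscTOfHalves_proof shaCardDvdPowAtTwoPosT_proof hL

end Summit.BirchSwinnertonDyer.BirchSwinnertonDyer.Theorems
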